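import Summits.RiemannHypothesis.RiemannHypothesis.Theorems.SignConeSignConeOscillatoryExtremalNonnegNormalise
import Literature.NumberTheory.LFunctions.WeilWindowSuzukiContinuityProofs

/-!
# Line `dual_witness` of crux `SignConeOscillatory` (stmt-RiemannHypothesis-16302): X₂ ⇔ crux, IV — approximation of a
# windowed finite-energy `L²` function by tests ON THE SAME WINDOW, with node values and `reWar` converging

**Theorem** (`exists_window_test_approx`).  Let `u ∈ L²`, `supp u ⊆ [-a, a]`, `∫|u|² = 1`, of finite archimedean energy.
Then there are Weil tests `wₙ` with `tsupport wₙ ⊆ [-a, a]`, `∫|wₙ|² = 1`, `(wₙ ⋆ w̃ₙ)(t) → (u ⋆ ũ)(t)` for every `t`, and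
`reWar (wₙ ⋆ w̃ₙ) → reWar (u ⋆ ũ)`.

Construction (Friedrichs + Bombieri): `wₙ = (ṽₙ)_{ηₙ}` is the unitary DILATE (`weilDilate`, `ηₙ = 1/(n+1)`) of the normalised
mollifier `ṽₙ` of part III (`tsupport ṽₙ ⊆ [-(a + a/(n+1)), a + a/(n+1)]`, so `tsupport wₙ ⊆ [-a, a]` exactly).  Node values:
`(wₙ ⋆ w̃ₙ)(t) = (ṽₙ ⋆ ṽ̃ₙ)((1+ηₙ)t)` (`weilConv_weilDilate_weilReflect`), `ṽₙ ⋆ ṽ̃ₙ → u ⋆ ũ` UNIFORMLY (Cauchy–Schwarz) and `u ⋆ ũ`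
is continuous (part I).  The form: `reWar = Re Q + Re (prime term)`; the prime term is a finite node sum, and
`|Re Q(wₙ) − Re Q(ṽₙ)| → 0` by the tree's UNIFORM dilation modulus `exists_weilDilate_modulus` (Suzuki-continuity file:
uniform over normalised tests on the window `2a` with bounded form values), while `reWar (ṽₙ ⋆ ṽ̃ₙ) → reWar (u ⋆ ũ)` by part III
and the landed `L²` toolkit. [folklore]
-/

noncomputable section

-- `Summit.RiemannHypothesis.RiemannHypothesis.…` repeats a namespace component by design (D-0017 layout).
set_option linter.dupNamespace false

open scoped BigOperators ComplexConjugate Topology ENNReal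
open MeasureTheory Set Filter Complex

namespace Summit.RiemannHypothesis.RiemannHypothesis.Theorems.SignCone.DualWitness

open Literature.NumberTheory.LFunctions Literature.Analysis.SpecialFunctions

/-- Shorthand: the `L²` norm as a real number. [folklore] -/
local notation "N₂" u:arg => ENNReal.toReal (eLpNorm u 2 MeasureTheory.MeasureSpace.volume)

variable {a : ℝ} {u : ℝ → ℂ}

/-- `reWar (g ⋆ g̃) = Re Q(g) + Re (prime term of g ⋆ g̃)`. [folklore] -/
theorem reWar_autocorr_eq_re_weilQuadratic_add (g : ℝ → ℂ) :
    reWar (autocorr g) = (weilQuadratic g).re + (weilPrimeTerm (autocorr g)).re := by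
  rw [reWar_eq, autocorr_eq_weilConv]
  simp only [weilQuadratic, weilFunctional, add_re, sub_re]
  ring

/-- The prime term of a kernel vanishing off `[-4a, 4a]` as a finite node sum of its values. [folklore] -/
theorem re_weilPrimeTerm_eq_sum {F : ℝ → ℂ} (hF : ∀ t : ℝ, 4 * a < |t| → F t = 0) :
    (weilPrimeTerm F).re = ∑ n ∈ Finset.range ⌈Real.exp (4 * a + 1)⌉₊,
      (ArithmeticFunction.vonMangoldt n : ℝ) / Real.sqrt n * (F (Real.log n) + F (-Real.log n)).re := by
  rw [WeilContinuous.weilPrimeTerm_eq_sum_of_support hF, Complex.re_sum]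
  refine Finset.sum_congr rfl fun n _ => ?_
  rw [show (((ArithmeticFunction.vonMangoldt n : ℝ) : ℂ) / (Real.sqrt n : ℂ)) =
      ((ArithmeticFunction.vonMangoldt n / Real.sqrt n : ℝ) : ℂ) by push_cast; rfl, re_ofReal_mul]

/-- **Approximation on the window.**  See the module docstring. [folklore] -/
theorem exists_window_test_approx : ∀ {a : ℝ} {u : ℝ → ℂ}, 0 < a → MemLp u 2 volume → Function.support u ⊆ Icc (-a) a → (∫ x, ‖u x‖ ^ 2 = 1) → Integrable (fun t : ℝ => ‖weilMellin u (1 / 2 + t * I)‖ ^ 2 * reDigammaQuarter t) → ∃ w : ℕ → ℝ → ℂ, (∀ n, IsWeilTest (w n) ∧ tsupport (w n) ⊆ Icc (-a) a ∧ ∫ x, ‖w n x‖ ^ 2 = 1) ∧ (∀ t : ℝ, Tendsto (fun n => autocorr (w n) t) atTop (𝓝 (autocorr u t))) ∧ Tendsto (fun n => reWar (autocorr (w n))) atTop (𝓝 (reWar (autocorr u))) := by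
  intro a u ha hu hsu hn1 hE
  obtain ⟨v, hv, hlim, hEn⟩ := exists_normalised_mollifier_seq ha hu hsu hn1 hE
  have ha2 : 0 < 2 * a := by positivity
  have hεle : ∀ n : ℕ, a / ((n : ℝ) + 1) ≤ a := fun n => by
    rw [div_le_iff₀ (by positivity)]; nlinarith [(Nat.cast_nonneg n : (0 : ℝ) ≤ n)]
  have hv2a : ∀ n, IsWeilTest (v n) ∧ tsupport (v n) ⊆ Icc (-(2 * a)) (2 * a) ∧ ∫ x, ‖v n x‖ ^ 2 = 1 := fun n =>
    ⟨(hv n).1, (hv n).2.1.trans (Icc_subset_Icc (by linarith [hεle n]) (by linarith [hεle n])), (hv n).2.2⟩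
  have hvmem : ∀ n, MemLp (v n) 2 volume := memLp_two_of_test hv2a
  have hvsupp : ∀ n, Function.support (v n) ⊆ Icc (-(2 * a)) (2 * a) := support_subset_of_test hv2a
  have hsu2 : Function.support u ⊆ Icc (-(2 * a)) (2 * a) := hsu.trans (Icc_subset_Icc (by linarith) (by linarith))
  have hui : Integrable u := integrable_of_memLp_two_of_support hu hsu
  have hu0 : (autocorr u 0).re = 1 := by rw [autocorr_zero_re, hn1]
  -- (A) the normalised mollifiers already converge in every respect except the support
  have hnode_v : ∀ t, Tendsto (fun n => autocorr (v n) t) atTop (𝓝 (autocorr u t)) := tendsto_autocorr hvmem hu hlim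
  have hpol : ∀ s, Tendsto (fun n => weilMellin (autocorr (v n)) s) atTop (𝓝 (weilMellin (autocorr u) s)) :=
    tendsto_weilMellin_autocorr hv2a hu hlim
  have hreWar_v : Tendsto (fun n => reWar (autocorr (v n))) atTop (𝓝 (reWar (autocorr u))) := by
    have e : ∀ n, reWar (autocorr (v n)) = (weilMellin (autocorr (v n)) 0 + weilMellin (autocorr (v n)) 1).re +
        1 / (2 * Real.pi) * (∫ t : ℝ, ‖weilMellin (v n) (1 / 2 + t * I)‖ ^ 2 * reDigammaQuarter t) - 1 * Real.log Real.pi := by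
      intro n
      rw [reWar_autocorr_eq ((hv n).1.1.continuous.integrable_of_hasCompactSupport (hv n).1.2), autocorr_zero_re, (hv n).2.2]
    simp_rw [e]
    rw [reWar_autocorr_eq hui, hu0]
    exact (((continuous_re.tendsto _).comp ((hpol 0).add (hpol 1))).add (hEn.const_mul _)).sub tendsto_const_nhds
  -- uniform convergence of the autocorrelations
  have hunif : Tendsto (fun n => N₂ (v n - u) * (N₂ (v n) + N₂ u)) atTop (𝓝 0) := by
    have hNu : N₂ u = 1 := by rw [toReal_eLpNorm_two_eq_sqrt hu, hn1, Real.sqrt_one]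
    have hNv : ∀ n, N₂ (v n) = 1 := toReal_eLpNorm_eq_one hv2a
    have hd : Tendsto (fun n => N₂ (v n - u)) atTop (𝓝 0) := by
      have h1 : Tendsto (fun n => Real.sqrt (∫ x, ‖v n x - u x‖ ^ 2)) atTop (𝓝 0) := by
        have h := (Real.continuous_sqrt.tendsto 0).comp hlim
        rw [Real.sqrt_zero] at h; exact h
      refine h1.congr fun n => ?_
      rw [toReal_eLpNorm_two_eq_sqrt ((hvmem n).sub hu)]; rfl
    simp_rw [hNv, hNu]
    simpa using hd.mul_const (1 + 1 : ℝ)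
  -- (B) the dilates
  set η : ℕ → ℝ := fun n => 1 / ((n : ℝ) + 1) with hη
  have hηpos : ∀ n, 0 < η n := fun n => by simp only [hη]; positivity
  have hηgt : ∀ n, -1 < η n := fun n => by linarith [hηpos n]
  have hηlim : Tendsto η atTop (𝓝 0) := tendsto_one_div_add_atTop_nhds_zero_nat
  set w : ℕ → ℝ → ℂ := fun n => weilDilate (η n) (v n) with hw
  have hwt : ∀ n, IsWeilTest (w n) := fun n => (hv n).1.weilDilate (hηgt n)
  have hwsupp : ∀ n, tsupport (w n) ⊆ Icc (-a) a := by
    intro n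
    refine (tsupport_weilDilate_subset (v n) (hηgt n) (hv n).2.1).trans ?_
    have e : (a + a / ((n : ℝ) + 1)) / (1 + η n) = a := by
      simp only [hη]; field_simp
    rw [e]
  have hwn : ∀ n, ∫ x, ‖w n x‖ ^ 2 = 1 := fun n => by rw [hw, integral_norm_sq_weilDilate _ (hηgt n), (hv n).2.2]
  have hwauto : ∀ n t, autocorr (w n) t = autocorr (v n) ((1 + η n) * t) := by
    intro n t
    rw [autocorr_eq_weilConv, autocorr_eq_weilConv, hw, weilConv_weilDilate_weilReflect _ (hηgt n)]
  -- (C) node values of the dilates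
  have hcontu : Continuous (autocorr u) := continuous_autocorr_of_memLp hu hsu
  have hnode_w : ∀ t, Tendsto (fun n => autocorr (w n) t) atTop (𝓝 (autocorr u t)) := by
    intro t
    simp_rw [hwauto]
    have h1 : Tendsto (fun n => autocorr u ((1 + η n) * t)) atTop (𝓝 (autocorr u t)) := by
      have : Tendsto (fun n => (1 + η n) * t) atTop (𝓝 ((1 + 0) * t)) := (tendsto_const_nhds.add hηlim).mul_const t
      rw [show (1 + 0 : ℝ) * t = t by ring] at this
      exact (hcontu.tendsto t).comp this
    have h2 : Tendsto (fun n => autocorr (v n) ((1 + η n) * t) - autocorr u ((1 + η n) * t)) atTop (𝓝 0) := by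
      rw [tendsto_zero_iff_norm_tendsto_zero]
      exact squeeze_zero (fun n => norm_nonneg _) (fun n => norm_autocorr_sub_autocorr_le (hvmem n) hu _) hunif
    have := h2.add h1
    simpa using this
  -- (D) the prime terms as finite node sums
  set K : ℕ := ⌈Real.exp (4 * a + 1)⌉₊ with hK
  have hfar_v : ∀ n t, 4 * a < |t| → autocorr (v n) t = 0 := fun n t ht =>
    autocorr_eq_zero_of_lt (t := t) (hvsupp n) (by linarith)
  have hfar_w : ∀ n t, 4 * a < |t| → autocorr (w n) t = 0 := by
    intro n t ht
    rw [hwauto]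
    refine hfar_v n _ (lt_of_lt_of_le ht ?_)
    rw [abs_mul, abs_of_pos (show (0 : ℝ) < 1 + η n by linarith [hηpos n])]
    nlinarith [abs_nonneg t, hηpos n]
  have hfar_u : ∀ t, 4 * a < |t| → autocorr u t = 0 := fun t ht => autocorr_eq_zero_of_lt (t := t) hsu (by linarith)
  have hprime_w : Tendsto (fun n => (weilPrimeTerm (autocorr (w n))).re) atTop (𝓝 (weilPrimeTerm (autocorr u)).re) := by
    rw [re_weilPrimeTerm_eq_sum hfar_u]
    simp_rw [re_weilPrimeTerm_eq_sum (hfar_w _)]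
    refine tendsto_finsetSum _ fun m _ => ?_
    exact ((continuous_re.tendsto _).comp ((hnode_w _).add (hnode_w _))).const_mul _
  have hprime_v : Tendsto (fun n => (weilPrimeTerm (autocorr (v n))).re) atTop (𝓝 (weilPrimeTerm (autocorr u)).re) := by
    rw [re_weilPrimeTerm_eq_sum hfar_u]
    simp_rw [re_weilPrimeTerm_eq_sum (hfar_v _)]
    refine tendsto_finsetSum _ fun m _ => ?_
    exact ((continuous_re.tendsto _).comp ((hnode_v _).add (hnode_v _))).const_mul _
  -- (E) Weil-form values of `ṽₙ` converge, hence are bounded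
  have hQv : Tendsto (fun n => (weilQuadratic (v n)).re) atTop (𝓝 (reWar (autocorr u) - (weilPrimeTerm (autocorr u)).re)) := by
    have e : ∀ n, (weilQuadratic (v n)).re = reWar (autocorr (v n)) - (weilPrimeTerm (autocorr (v n))).re := fun n => by
      rw [reWar_autocorr_eq_re_weilQuadratic_add]; ring
    simp_rw [e]
    exact hreWar_v.sub hprime_v
  obtain ⟨E, hEbd⟩ := hQv.bddAbove_range
  have hEbd' : ∀ n, (weilQuadratic (v n)).re ≤ E := fun n => hEbd ⟨n, rfl⟩
  -- (F) the dilation changes `Re Q` by `o(1)` (uniform modulus on the window `2a`)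
  have hQdiff : Tendsto (fun n => (weilQuadratic (w n)).re - (weilQuadratic (v n)).re) atTop (𝓝 0) := by
    rw [Metric.tendsto_atTop]
    intro ε hε
    obtain ⟨δ, hδ, -, hmod⟩ := exists_weilDilate_modulus ha2 E (half_pos hε)
    obtain ⟨N₀, hN₀⟩ := (Metric.tendsto_atTop.mp hηlim) δ hδ
    refine ⟨N₀, fun n hn => ?_⟩
    have hηn : |η n| ≤ δ := by
      have := hN₀ n hn; rw [Real.dist_eq, sub_zero] at this; exact this.le
    have h := hmod (η n) hηn (v n) (hv2a n).1 (hv2a n).2.1 (hv2a n).2.2 (hEbd' n)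
    rw [Real.dist_eq, sub_zero]
    exact lt_of_le_of_lt h (half_lt_self hε)
  refine ⟨w, fun n => ⟨hwt n, hwsupp n, hwn n⟩, hnode_w, ?_⟩
  have e : ∀ n, reWar (autocorr (w n)) = ((weilQuadratic (w n)).re - (weilQuadratic (v n)).re) +
      (weilQuadratic (v n)).re + (weilPrimeTerm (autocorr (w n))).re := fun n => by
    rw [reWar_autocorr_eq_re_weilQuadratic_add]; ring
  simp_rw [e]
  have h := (hQdiff.add hQv).add hprime_w
  rw [show (0 : ℝ) + (reWar (autocorr u) - (weilPrimeTerm (autocorr u)).re) + (weilPrimeTerm (autocorr u)).re =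
    reWar (autocorr u) by ring] at h
  exact h

end Summit.RiemannHypothesis.RiemannHypothesis.Theorems.SignCone.DualWitness

end
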